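import Literature.MathematicalPhysics.QuantumFieldTheory.Balaban1983to89.B9Ineq349SiteFromBlocks
import Literature.MathematicalPhysics.QuantumFieldTheory.Balaban1983to89.B9BackgroundsKLevelV1R

/-!
# `Balaban1983to89.B9Ineq349SiteFromBlocksR` — ROW 25 ((3.49) for the genuine `P = I − R(U)`) OF THE N06 KNIT RE-PRESSED ONCE OVER THE CLASS-PARAMETRIC
# CARRIER `bg9YR R₁ R₂` (dag-lead CASCADE-R; the R-twin of dag-n06-i's `B9Ineq349SiteFromBlocks.stmt349Printed_site_of_blockSchemas`)

B9 = T. Bałaban, *Propagators for lattice gauge theories in a background field*, Commun. Math. Phys. **99** (1985) 389–434 [`Balaban1985BackgroundPropagators`];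
[4] = T. Bałaban, *Propagators and renormalization transformations for lattice gauge theories. II*, Commun. Math. Phys. **96** (1984) 223–250 [`Balaban1984PropagatorsII`].
pub-ymgap Track A, node N06 = `Dag.B9_main`; plan of record dag-lead CASCADE-R (edition ≥ 8 of the certificate is pressed at `B9PinCarriersKLevelV1R.carriersYR … R₁ R₂ ops`,
whose binder reads `s349 : B9.Stmt349Printed (d + 1) c35Y geo9Y (bg9YR 𝔸 G R₁ R₂) (fun x => fineKernelR R₁ R₂ (ops x).P349)`).
APPEND-ONLY companion of dag-n06-i's `B9Ineq349SiteFromBlocks` (row 25, untouched, consumed by name) and def-Y's MODULE 3-R `B9BackgroundsKLevelV1R`.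
Nothing of [B9] asserted; count-neutral; N06 NOT discharged.

WHY A TWIN IS NEEDED HERE (and why it is mechanical).  Unlike the `U = 1` rows, (3.49) is a statement AT EVERY `U` IN THE CLASS (3.35): both the two
Thm 3.1 ∕ Thm 3.2-type input schemas `Thm31SiteSchemas` ∕ `Thm32BlkSchema` and the conclusion `B9.Stmt349Printed` carry the premise `(bg x).Reg335 c35 α₀ U →`.
Over `bg9YR 𝔸 G R₁ R₂` that premise is the PARAMETER `R₁ x c35 α₀ U` (`bg9YR_reg335_iff`, `Iff.rfl`); dag-n06-i's derivation `exists_threshold_349` (Lemma 2.1 on the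
member's torus + the power counting) is a statement about ONE configuration `U : CfgY` and never reads the class — so the proof text of
`stmt349Printed_site_of_blockSchemas` re-presses VERBATIM once the two input schemas are re-typed over the carrier (§1).

WHAT IS DEFINED ∕ PROVED.
* §1 `Thm31SiteSchemasR 𝔸 G c35 𝔏 R₁ R₂` ∕ `Thm32BlkSchemaR 𝔸 G c35 𝔏 R₁ R₂` — dag-n06-i's input schemas with the class premise read at the carrier
  `(bg9YR 𝔸 G R₁ R₂ x).Reg335 c35 α₀ U` (bodies otherwise verbatim); coherence `thm31SiteSchemasR_regY_iff` ∕ `thm32BlkSchemaR_regY_iff` (`Iff.rfl`: at MODULE 3's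
  families the re-typed schema IS the landed one).
* §2 ★★★ `stmt349Printed_site_of_blockSchemas_R 𝔏 R₁ R₂ h31 h32 : B9.Stmt349Printed (d+1) c35 geo9Y (bg9YR 𝔸 G R₁ R₂) (fun x => fineKernelR R₁ R₂ (p349SiteY 𝔸 G x (𝔏 x)))`
  — row 25 at generic `(R₁, R₂)` (same proof text); at `𝔏 := lettersYOfRecordV4 …` this IS the edition-≥8 binder `s349` at every instance whose `.P349` slot is
  `p349SiteY … (𝔏 x)` by `rfl` (as editions 7 ∕ 8 already use it: `…V6EPairMT` :323, `…V6EPairMC` :287); coherence `stmt349Printed_site_R_regY_iff` (`Iff.rfl`).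
HONEST SCOPE: re-typing bookkeeping over a landed derivation; the two inputs remain HYPOTHESES (printed-type, block-complete; adjoint side located, as in the
original); the class (3.35) is a PARAMETER nothing here reads; one finite lattice programme; NOT continuum ∕ OS ∕ mass gap ∕ Clay.  No `sorry`, no `axiom`,
no `instance`, no `notation`, default heartbeats.
-/

noncomputable section

namespace Literature.MathematicalPhysics.QuantumFieldTheory.Balaban1983to89.B9Ineq349SiteFromBlocksR

open Node00
open B6KLevelCensusIndexV1 (KIdx)
open B6Ineq2142KLevelV1 (β)
open B9Ineq349SiteReading (fineEntryS p349SiteY)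
open B9Ineq349SiteComposite (Left342At Right342At Blk348At)
open B9Ineq349SiteFromBlocks (Thm31SiteSchemas Thm32BlkSchema exists_threshold_349 geo9Y_len_eq_lenB geo9Y_dist_eq_distB geo9Y_M_eq p349SiteY_ker)
open B9PinMembersKLevelV1 (MemberY geo9Y bg9Y)
open B9BackgroundsKLevelV1R (RegFamY bg9YR regY335 regY336 fineKernelR)

variable {d ℓ : ℕ} {hd : 1 ≤ d + 1} {hL : Odd (ℓ + 1) ∧ 1 < ℓ + 1} {b₀ b₁ : ℝ} {Mstar : ℕ}

/-! ## §1 The two input schemas over the class-parametric carrier -/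

section Schemas

variable (𝔸 : Type) [NormedRing 𝔸] [NormedAlgebra ℂ 𝔸] [CompleteSpace 𝔸] (G : Subgroup 𝔸ˣ)

/-- **THM 3.1-TYPE INPUT FOR (3.49) OVER `bg9YR R₁ R₂`**: dag-n06-i's `Thm31SiteSchemas` with the class premise read at the carrier (`= R₁ x c35 α₀ U`).
Hypothesis shape. [cite: Balaban1985BackgroundPropagators, Thm 3.1 (3.42) p.397 with (3.25) p.394; p.396 (the class as a parameter)] -/
def Thm31SiteSchemasR (c35 : ℝ) (𝔏 : ∀ x : MemberY d ℓ hd hL b₀ b₁ Mstar, CovLettersY 𝔸 x) (R₁ R₂ : RegFamY d ℓ hd hL b₀ b₁ Mstar 𝔸) : Prop :=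
  ∃ M₁ δ₀ a₀ B₀ : ℝ, 0 < M₁ ∧ 0 < δ₀ ∧ 0 < a₀ ∧ 0 < B₀ ∧
    ∀ x : MemberY d ℓ hd hL b₀ b₁ Mstar, M₁ ≤ (geo9Y x).M → ∀ α₀ : ℝ, 0 < α₀ → (geo9Y x).M * α₀ ≤ a₀ →
      ∀ U : (bg9YR 𝔸 G R₁ R₂ x).Cfg, (bg9YR 𝔸 G R₁ R₂ x).Reg335 c35 α₀ U →
        Left342At x.toKIdx (𝔏 x).parS (𝔏 x).Gp U B₀ δ₀ ∧ Right342At x.toKIdx (𝔏 x).parS (𝔏 x).Gp U B₀ δ₀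

/-- **THM 3.2-TYPE INPUT FOR (3.49) OVER `bg9YR R₁ R₂`**: dag-n06-i's `Thm32BlkSchema` with the class premise read at the carrier.  Hypothesis shape.
[cite: Balaban1985BackgroundPropagators, Thm 3.2 (3.48) p.398; p.396 (the class as a parameter)] -/
def Thm32BlkSchemaR (c35 : ℝ) (𝔏 : ∀ x : MemberY d ℓ hd hL b₀ b₁ Mstar, CovLettersY 𝔸 x) (R₁ R₂ : RegFamY d ℓ hd hL b₀ b₁ Mstar 𝔸) : Prop :=
  ∃ M₁ δ₁ a₀ B₁ : ℝ, 0 < M₁ ∧ 0 < δ₁ ∧ 0 < a₀ ∧ 0 < B₁ ∧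
    ∀ x : MemberY d ℓ hd hL b₀ b₁ Mstar, M₁ ≤ (geo9Y x).M → ∀ α₀ : ℝ, 0 < α₀ → (geo9Y x).M * α₀ ≤ a₀ →
      ∀ U : (bg9YR 𝔸 G R₁ R₂ x).Cfg, (bg9YR 𝔸 G R₁ R₂ x).Reg335 c35 α₀ U → Blk348At x.toKIdx (𝔏 x).parS (𝔏 x).Gp U B₁ δ₁

/-- coherence: at MODULE 3's families the re-typed Thm 3.1-type schema IS dag-n06-i's. [cite: Balaban1985BackgroundPropagators, p.396 (bookkeeping: the two readings of the class)] -/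
theorem thm31SiteSchemasR_regY_iff (c35 : ℝ) (𝔏 : ∀ x : MemberY d ℓ hd hL b₀ b₁ Mstar, CovLettersY 𝔸 x) :
    Thm31SiteSchemasR 𝔸 G c35 𝔏 (regY335 𝔸 G) (regY336 𝔸 G) ↔ Thm31SiteSchemas 𝔸 G c35 𝔏 := Iff.rfl

/-- coherence: at MODULE 3's families the re-typed Thm 3.2-type schema IS dag-n06-i's. [cite: Balaban1985BackgroundPropagators, p.396 (bookkeeping)] -/
theorem thm32BlkSchemaR_regY_iff (c35 : ℝ) (𝔏 : ∀ x : MemberY d ℓ hd hL b₀ b₁ Mstar, CovLettersY 𝔸 x) :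
    Thm32BlkSchemaR 𝔸 G c35 𝔏 (regY335 𝔸 G) (regY336 𝔸 G) ↔ Thm32BlkSchema 𝔸 G c35 𝔏 := Iff.rfl

end Schemas

/-! ## §2 Row 25 at generic `(R₁, R₂)` -/

section Record

variable {𝔸 : Type} [NormedRing 𝔸] [NormedAlgebra ℂ 𝔸] [CompleteSpace 𝔸] {G : Subgroup 𝔸ˣ}

/-- ★★★ **ROW 25 OF THE N06 KNIT OVER THE CLASS-PARAMETRIC CARRIER**: the printed (3.49) for the genuine `P = I − R(U)` of a letter family, read at the
carrier blocks through the re-typed fine kernel, from the two block-complete inputs over `bg9YR R₁ R₂` — dag-n06-i's `stmt349Printed_site_of_blockSchemas`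
re-pressed (same thresholds `max`, rate `θ = min(δ₀,δ₁)∕8` displayed as `½·(2θ)`, constant `B₀B₁B₀·C_g`; the derivation `exists_threshold_349` is class-free).
At `𝔏 := lettersYOfRecordV4 …` this is the edition-≥8 binder `s349` of `b9LeafX_carriersYR`.
[cite: Balaban1985BackgroundPropagators, (3.49) p.399; Thm 3.1 (3.42) p.397; Thm 3.2 (3.48) p.398; p.396 (the class as a parameter); Balaban1984PropagatorsII, Lemma 2.1 p.234] -/
theorem stmt349Printed_site_of_blockSchemas_R {c35 : ℝ} (𝔏 : ∀ x : MemberY d ℓ hd hL b₀ b₁ Mstar, CovLettersY 𝔸 x)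
    (R₁ R₂ : RegFamY d ℓ hd hL b₀ b₁ Mstar 𝔸) (h31 : Thm31SiteSchemasR 𝔸 G c35 𝔏 R₁ R₂) (h32 : Thm32BlkSchemaR 𝔸 G c35 𝔏 R₁ R₂) :
    B9.Stmt349Printed (d + 1) c35 (geo9Y (d := d) (ℓ := ℓ) (hd := hd) (hL := hL) (b₀ := b₀) (b₁ := b₁) (Mstar := Mstar)) (bg9YR 𝔸 G R₁ R₂)
      (fun x => fineKernelR R₁ R₂ (p349SiteY 𝔸 G x (𝔏 x))) := by
  obtain ⟨M₁, δ₀, a₀, B₀, hM₁, hδ₀, ha₀, hB₀, H31⟩ := h31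
  obtain ⟨M₁', δ₁, a₀', B₁, hM₁', hδ₁, ha₀', hB₁, H32⟩ := h32
  obtain ⟨M₃, θ, Cg, hM₃, hθ, hCg, -, H⟩ := exists_threshold_349 (d := d) (ℓ := ℓ) (hd := hd) (hL := hL) (b₀ := b₀) (b₁ := b₁) hδ₀ hδ₁
  refine ⟨max M₁ (max M₁' M₃), 2 * θ, min a₀ a₀', B₀ * B₁ * B₀ * Cg, lt_max_of_lt_left hM₁, by positivity, lt_min ha₀ ha₀', by positivity, ?_⟩
  intro x hMx α₀ hα₀ hMa U hU n b b'
  have hM1 : M₁ ≤ (geo9Y x).M := (le_max_left _ _).trans hMx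
  have hM1' : M₁' ≤ (geo9Y x).M := ((le_max_left _ _).trans (le_max_right _ _)).trans hMx
  have hM3 : M₃ ≤ ((ℓ : ℝ) + 1) * x.Mh := by rw [← geo9Y_M_eq]; exact ((le_max_right _ _).trans (le_max_right _ _)).trans hMx
  obtain ⟨hLe, hRi⟩ := H31 x hM1 α₀ hα₀ (hMa.trans (min_le_left _ _)) U hU
  have h348 := H32 x hM1' α₀ hα₀ (hMa.trans (min_le_right _ _)) U hU
  have key := H x.toKIdx hM3 (𝔏 x).parS (𝔏 x).Gp U hB₀.le hB₁.le hLe hRi h348 n (β x.hN x.D x.hk b) (β x.hN x.D x.hk b')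
  show (p349SiteY 𝔸 G x (𝔏 x)).ker n U b b' ≤ _
  rw [p349SiteY_ker, geo9Y_len_eq_lenB, geo9Y_len_eq_lenB, geo9Y_dist_eq_distB,
    show 2 * θ / 2 = θ by ring]
  exact key

/-- coherence: at MODULE 3's families `(regY335, regY336)` the re-pressed row 25 IS dag-n06-i's statement (`bg9Y_eq_bg9YR`, `fineKernelR` entries, `rfl`).
[cite: Balaban1985BackgroundPropagators, p.396 + (3.49) p.399 (bookkeeping)] -/
theorem stmt349Printed_site_R_regY_iff {c35 : ℝ} (𝔏 : ∀ x : MemberY d ℓ hd hL b₀ b₁ Mstar, CovLettersY 𝔸 x) :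
    B9.Stmt349Printed (d + 1) c35 (geo9Y (d := d) (ℓ := ℓ) (hd := hd) (hL := hL) (b₀ := b₀) (b₁ := b₁) (Mstar := Mstar))
        (bg9YR 𝔸 G (regY335 𝔸 G) (regY336 𝔸 G)) (fun x => fineKernelR (regY335 𝔸 G) (regY336 𝔸 G) (p349SiteY 𝔸 G x (𝔏 x))) ↔
      B9.Stmt349Printed (d + 1) c35 geo9Y (bg9Y 𝔸 G) (fun x => p349SiteY 𝔸 G x (𝔏 x)) :=
  Iff.rfl

end Record

end Literature.MathematicalPhysics.QuantumFieldTheory.Balaban1983to89.B9Ineq349SiteFromBlocksR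

end
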